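import Summits.Schanuel.Schanuel.Theorems.RootDecomp1KLogLogCell05

/-!
# RootDecomp1KLogLogCell — lens 1, generation 35 «LOG-LOG CELL of 33364» (RootDecomp1KLogLogCell.lean 05ce2a21…, 1940 l) — continuation (RootDecomp1KLogLogCell06): §6 second half — `rhoE_sub_rat_lower_logsq` (scoped `maxHeartbeats 400000`, see PORT comment), `not_logSqLiouville_rhoE`, `not_logHyperLiouville_rhoE`, `not_hyperLiouville_rhoE`

(lens-1 g35 `RootDecomp1KLogLogCell.lean`, sha256 05ce2a21…c847, own farm rc 0 · 0 sorry · axioms std; critic VERDICT STATUS L1698 PORT GO LOW;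
port by census-1 gen 15 in eight parts `RootDecomp1KLogLogCell01`–`08` — see the PORT NOTE of part 01; `--supports stmt-Schanuel-33364`; rung 0.)
-/

noncomputable section

open Complex IntermediateField Polynomial
open Summit.Schanuel.Schanuel.Theorems.RootDecomp1KHyper
open Summit.Schanuel.Schanuel.Theorems.RootDecomp1KHyper.HyperCell
open Summit.Schanuel.Schanuel.Theorems.RootDecomp1KGeneric
open Summit.Schanuel.Schanuel.Theorems.RootDecomp1KRelLiouvilleCell

namespace Summit.Schanuel.Schanuel.Theorems.RootDecomp1KLogLogCell

section Member
open LiouvilleNumber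
open scoped Nat

/-- `(2k+1)(2k+2)(2k+3)(2k+4) ≤ 180 · (2k)!` for `k ≥ 1` (equality at `k = 1`). -/
private theorem prod_four_le_factorial {k : ℕ} (hk : 1 ≤ k) :
    (2 * k + 1) * (2 * k + 2) * (2 * k + 3) * (2 * k + 4) ≤ 180 * (2 * k)! := by
  induction k, hk using Nat.le_induction with
  | base => decide
  | succ n hn ih =>
    have e1 : (2 * (n + 1))! = (2 * n)! * ((2 * n + 1) * (2 * n + 2)) := efact_succ n
    have e2 : 2 * (n + 1) = 2 * n + 2 := by ring
    rw [e2] at e1 ⊢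
    have hu : 12 ≤ (2 * n + 1) * (2 * n + 2) := by nlinarith
    have h0 : (2 * n + 5) * (2 * n + 6) ≤ 12 * ((2 * n + 1) * (2 * n + 2)) := by nlinarith
    have h1 : (2 * n + 5) * (2 * n + 6) ≤ (2 * n + 1) * (2 * n + 2) * ((2 * n + 1) * (2 * n + 2)) :=
      h0.trans (Nat.mul_le_mul_right _ hu)
    calc (2 * n + 2 + 1) * (2 * n + 2 + 2) * (2 * n + 2 + 3) * (2 * n + 2 + 4)
        = (2 * n + 3) * (2 * n + 4) * ((2 * n + 5) * (2 * n + 6)) := by ring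
      _ ≤ (2 * n + 3) * (2 * n + 4) * ((2 * n + 1) * (2 * n + 2) * ((2 * n + 1) * (2 * n + 2))) :=
          Nat.mul_le_mul_left _ h1
      _ = ((2 * n + 1) * (2 * n + 2) * (2 * n + 3) * (2 * n + 4)) * ((2 * n + 1) * (2 * n + 2)) := by
          ring
      _ ≤ (180 * (2 * n)!) * ((2 * n + 1) * (2 * n + 2)) := Nat.mul_le_mul_right _ ih
      _ = 180 * (2 * n + 2)! := by rw [e1]; ring

-- PORT (census-1 gen 15): this proof sits at the edge of the default heartbeat budget (it passes in the lens's single file and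
-- times out deterministically in `field_simp` once the file is split); a scoped bump keeps it verbatim.
set_option maxHeartbeats 400000 in

-- PORT (census-1 gen 15): this proof sits at the edge of the default heartbeat budget (it passes in the lens's single file and
-- times out deterministically in `field_simp` once the file is split); a scoped bump keeps it verbatim.
set_option maxHeartbeats 400000 in
/-- **Effective irrationality measure of `ρ_E` at the log-square scale**: `|ρ_E − p/q| ≥ exp(−271 (log q)²)`
for every rational `p/q` with `q ≥ 4` (two cases on whether `p/q` is the convergent `M/2^{(2(k+1))!}`,
`2^{(2k)!} ≤ q < 2^{(2(k+1))!}`; adapted from the tree's `liouvilleNumber_sub_rat_lower_logsq`). -/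
theorem rhoE_sub_rat_lower_logsq (r : ℚ) (hq4 : 4 ≤ r.den) :
    Real.exp (-(271 * Real.log r.den ^ 2)) ≤ |rhoE - r| := by
  classical
  set q : ℕ := r.den with hqdef
  have hq1R : (1 : ℝ) ≤ q := by exact_mod_cast (show 1 ≤ q by omega)
  have hq0R : (0 : ℝ) < q := by linarith
  have hq4R : (4 : ℝ) ≤ q := by exact_mod_cast hq4
  set L : ℝ := Real.log q with hLdef
  have hL1 : 1 ≤ L := by
    rw [hLdef, Real.le_log_iff_exp_le hq0R]
    have := Real.exp_one_lt_d9; linarith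
  have hL0 : 0 ≤ L := by linarith
  have hqpow : ∀ n : ℕ, (q : ℝ) ^ n = Real.exp ((n : ℝ) * L) := fun n => by
    rw [Real.exp_nat_mul, hLdef, Real.exp_log hq0R]
  -- `k ≥ 1` with `2^{(2k)!} ≤ q < 2^{(2(k+1))!}`
  have hex : ∃ j : ℕ, q < 2 ^ (2 * (j + 1))! :=
    ⟨q, (Nat.lt_two_pow_self).trans_le (Nat.pow_le_pow_right (by norm_num)
      ((show q ≤ 2 * (q + 1) by omega).trans (Nat.self_le_factorial _)))⟩
  set k : ℕ := Nat.find hex with hk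
  have hkP : q < 2 ^ (2 * (k + 1))! := Nat.find_spec hex
  have hk1 : 1 ≤ k := by
    by_contra h0
    have h00 : k = 0 := by omega
    rw [h00] at hkP
    have e2 : (2 * (0 + 1))! = 2 := by decide
    rw [e2] at hkP
    norm_num at hkP
    omega
  have hklow : 2 ^ (2 * k)! ≤ q := by
    have h := Nat.find_min hex (m := k - 1) (by omega)
    rw [Nat.sub_add_cancel hk1] at h
    exact not_lt.mp h
  -- `(2k)! ≤ (3/2) log q`
  have hfact : (((2 * k)! : ℕ) : ℝ) ≤ 3 / 2 * L := by
    have h1 : (2 : ℝ) ^ (2 * k)! ≤ q := by exact_mod_cast hklow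
    have h2 : (((2 * k)! : ℕ) : ℝ) * Real.log 2 ≤ L := by
      rw [← Real.log_pow]; exact Real.log_le_log (by positivity) h1
    have h4 := Real.log_two_gt_d9
    have h5 : (0 : ℝ) ≤ ((2 * k)! : ℕ) := Nat.cast_nonneg _
    nlinarith
  -- the two exponents `e₁ = (2k+1)(2k+2)`, `e₂ = (2k+3)(2k+4)`
  set e₁ : ℕ := (2 * k + 1) * (2 * k + 2) with he₁
  set e₂ : ℕ := (2 * k + 3) * (2 * k + 4) with he₂
  have hfac1 : (2 * (k + 1))! = (2 * k)! * e₁ := by rw [he₁]; exact efact_succ k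
  have hfac2 : (2 * (k + 2))! = (2 * (k + 1))! * e₂ := by
    have h := efact_succ (k + 1)
    rw [show k + 1 + 1 = k + 2 by ring, show 2 * (k + 1) + 1 = 2 * k + 3 by ring,
      show 2 * (k + 1) + 2 = 2 * k + 4 by ring] at h
    rw [he₂]; exact h
  have he₁pos : 0 < e₁ := by rw [he₁]; exact Nat.mul_pos (by omega) (by omega)
  have he₂3 : 3 ≤ e₂ := by rw [he₂]; nlinarith
  have h180 : e₁ * e₂ ≤ 180 * (2 * k)! :=
    calc e₁ * e₂ = (2 * k + 1) * (2 * k + 2) * (2 * k + 3) * (2 * k + 4) := by rw [he₁, he₂]; ring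
      _ ≤ 180 * (2 * k)! := prod_four_le_factorial hk1
  have hE1 : ((e₁ * e₂ : ℕ) : ℝ) * L ≤ 270 * L ^ 2 := by
    have h1 : ((e₁ * e₂ : ℕ) : ℝ) ≤ 180 * (((2 * k)! : ℕ) : ℝ) := by exact_mod_cast h180
    nlinarith [hfact, hL0]
  have hE2 : ((e₁ + 1 : ℕ) : ℝ) * L ≤ 270 * L ^ 2 := by
    have h0 : e₁ + 1 ≤ e₁ * e₂ := by nlinarith [he₁pos, he₂3]
    have h1 : ((e₁ + 1 : ℕ) : ℝ) ≤ ((e₁ * e₂ : ℕ) : ℝ) := by exact_mod_cast h0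
    nlinarith [hE1, hL0]
  -- `D := 2^{(2(k+1))!}`
  set D : ℝ := (2 : ℝ) ^ (2 * (k + 1))! with hD
  have hD0 : 0 < D := by positivity
  have hqD : (q : ℝ) < D := by rw [hD]; exact_mod_cast hkP
  have hqD' : (q : ℝ) ≤ D := hqD.le
  have hDq : D ≤ (q : ℝ) ^ e₁ := by
    have e : D = ((2 : ℝ) ^ (2 * k)!) ^ e₁ := by rw [hD, ← pow_mul, hfac1]
    rw [e]
    exact pow_le_pow_left₀ (by positivity) (by exact_mod_cast hklow) _
  have hD' : (2 : ℝ) ^ (2 * (k + 2))! = D ^ e₂ := by rw [hD, ← pow_mul, hfac2]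
  have hD4 : (4 : ℝ) ≤ D := hq4R.trans hqD'
  -- partial sum `P = M/D` and tail `R`
  obtain ⟨Mn, hModd, hP⟩ := rhoE_partialSum (k + 1)
  set P : ℝ := ∑ i ∈ Finset.range (k + 2), 1 / (2 : ℝ) ^ (2 * i)! with hPdef
  have hPD : P = (Mn : ℝ) / D := by rw [hD]; exact hP
  set R : ℝ := ∑' i, 1 / (2 : ℝ) ^ (2 * (i + (k + 2)))! with hRdef
  have hℓ : rhoE = P + R := by rw [hPdef, hRdef]; exact rhoE_eq_partialSum_add_tail (k + 2)
  have hRpos : 0 < R := rhoE_tail_pos (k + 2)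
  have hRge : 1 / D ^ e₂ ≤ R := by rw [← hD']; exact rhoE_first_le_tail (k + 2)
  have hRle : R ≤ 1 / (q * D) / 2 := by
    have h1 : R ≤ 2 * (1 / (2 : ℝ) ^ (2 * (k + 2))!) := rhoE_tail_le (k + 2)
    rw [hD'] at h1
    have h3 : 2 * (1 / D ^ e₂) ≤ 2 * (1 / D ^ 3) :=
      mul_le_mul_of_nonneg_left
        (one_div_pow_le_one_div_pow_of_le (le_trans (by norm_num) hD4) he₂3) (by norm_num)
    have h4 : 2 * (1 / D ^ 3) ≤ 1 / (q * D) / 2 := by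
      rw [mul_one_div, div_div, div_le_div_iff₀ (by positivity) (by positivity), one_mul]
      have h5 : (q : ℝ) * D ≤ D * D := mul_le_mul_of_nonneg_right hqD' hD0.le
      have h6 : 4 * (D * D) ≤ D * (D * D) := mul_le_mul_of_nonneg_right hD4 (by positivity)
      nlinarith
    linarith
  have hhalf : Real.exp (-(271 * L ^ 2)) ≤ Real.exp (-(270 * L ^ 2)) / 2 := by
    have h2 : (2 : ℝ) ≤ Real.exp (L ^ 2) := by nlinarith [Real.add_one_le_exp (L ^ 2)]
    rw [le_div_iff₀ (by norm_num : (0 : ℝ) < 2)]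
    calc Real.exp (-(271 * L ^ 2)) * 2 ≤ Real.exp (-(271 * L ^ 2)) * Real.exp (L ^ 2) :=
          mul_le_mul_of_nonneg_left h2 (Real.exp_pos _).le
      _ = Real.exp (-(270 * L ^ 2)) := by rw [← Real.exp_add]; congr 1; ring
  by_cases hrP : (r : ℝ) = P
  · -- `r` is the convergent: `|ρ_E − r| = R ≥ 1/D^{e₂} ≥ q^{−e₁ e₂} ≥ exp(−270 L²)`
    rw [hℓ, hrP, add_sub_cancel_left, abs_of_pos hRpos]
    refine le_trans ?_ hRge
    have h1 : 1 / (q : ℝ) ^ (e₁ * e₂) ≤ 1 / D ^ e₂ := by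
      apply one_div_le_one_div_of_le (by positivity)
      calc D ^ e₂ ≤ ((q : ℝ) ^ e₁) ^ e₂ := pow_le_pow_left₀ hD0.le hDq _
        _ = (q : ℝ) ^ (e₁ * e₂) := by rw [← pow_mul]
    refine le_trans ?_ h1
    rw [hqpow, one_div, ← Real.exp_neg, Real.exp_le_exp, neg_le_neg_iff]
    nlinarith [hE1, sq_nonneg L]
  · -- `r ≠ P`: `|r − P| ≥ 1/(qD)` and `R ≤ 1/(2qD)`
    set Nz : ℤ := r.num * (2 : ℤ) ^ (2 * (k + 1))! - (Mn : ℤ) * q with hN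
    have hrq : (r : ℝ) = (r.num : ℝ) / q := by rw [hqdef]; exact_mod_cast r.num_div_den.symm
    have hdiff : (r : ℝ) - P = (Nz : ℝ) / (q * D) := by
      rw [hrq, hPD, hN, hD]
      push_cast
      field_simp
    have hN0 : Nz ≠ 0 := by
      intro h0
      apply hrP
      have : (r : ℝ) - P = 0 := by rw [hdiff, h0]; simp
      linarith
    have hN1 : (1 : ℝ) ≤ |(Nz : ℝ)| := by exact_mod_cast Int.one_le_abs hN0
    have hsep : 1 / (q * D) ≤ |(r : ℝ) - P| := by
      rw [hdiff, abs_div, abs_of_pos (by positivity : (0 : ℝ) < q * D)]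
      exact div_le_div_of_nonneg_right hN1 (by positivity)
    have htri : |(r : ℝ) - P| - R ≤ |rhoE - r| := by
      rw [hℓ]
      have e : P + R - (r : ℝ) = R - ((r : ℝ) - P) := by ring
      rw [e, abs_sub_comm R ((r : ℝ) - P)]
      have h1 := abs_sub_abs_le_abs_sub ((r : ℝ) - P) R
      rw [abs_of_pos hRpos] at h1
      exact h1
    refine le_trans ?_ htri
    have hqD2 : 1 / (q : ℝ) ^ (e₁ + 1) / 2 ≤ 1 / (q * D) / 2 := by
      have h1 : (q : ℝ) * D ≤ (q : ℝ) ^ (e₁ + 1) := by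
        rw [pow_succ']; exact mul_le_mul_of_nonneg_left hDq hq0R.le
      have h2 : 1 / (q : ℝ) ^ (e₁ + 1) ≤ 1 / (q * D) :=
        one_div_le_one_div_of_le (by positivity) h1
      linarith
    have hx : Real.exp (-(270 * L ^ 2)) ≤ 1 / (q : ℝ) ^ (e₁ + 1) := by
      rw [hqpow, one_div, ← Real.exp_neg, Real.exp_le_exp, neg_le_neg_iff]
      linarith [hE2]
    have hmain : Real.exp (-(271 * L ^ 2)) ≤ 1 / (q : ℝ) ^ (e₁ + 1) / 2 :=
      hhalf.trans (div_le_div_of_nonneg_right hx (by norm_num))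
    linarith

/-- **`ρ_E` is NOT log-square-Liouville** (the tree class `RootDecomp1KGeneric.LogSqLiouville`). -/
theorem not_logSqLiouville_rhoE : ¬ LogSqLiouville rhoE := by
  intro hH
  obtain ⟨r, hden, _, hlt⟩ := hH 275
  have hq4 : 4 ≤ r.den := le_trans (by norm_num) hden
  have hlow := rhoE_sub_rat_lower_logsq r hq4
  have hq0R : (0 : ℝ) < r.den := by exact_mod_cast r.den_pos
  have hL0 : 0 ≤ Real.log r.den := Real.log_nonneg (by exact_mod_cast r.den_pos)
  have hmono : Real.exp (-((275 : ℕ) * Real.log r.den ^ 2)) ≤ Real.exp (-(271 * Real.log r.den ^ 2)) := by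
    rw [Real.exp_le_exp, neg_le_neg_iff]
    push_cast
    nlinarith [sq_nonneg (Real.log r.den)]
  linarith

/-- Hence `ρ_E` is NOT log-hyper-Liouville (g34's class) … -/
theorem not_logHyperLiouville_rhoE : ¬ LogHyperLiouville rhoE := fun h =>
  not_logSqLiouville_rhoE (LogHyperLiouville.logSqLiouville h)

/-- … and NOT hyper-Liouville (the route's `HyperLiouvilleSchanuel` class). -/
theorem not_hyperLiouville_rhoE : ¬ HyperLiouville rhoE := fun h =>
  not_logHyperLiouville_rhoE (HyperLiouville.logHyperLiouville h)

end Member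

end Summit.Schanuel.Schanuel.Theorems.RootDecomp1KLogLogCell
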